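import Summits.CriticalPhenomena.PercolationContinuityZ3.Theorems.FK.Transplant.KNFreeSlabColumnRoutes
import HarnessLib

/-!
# FRONTIER TRANSPLANT, binder 2 (TP_FK) — T4-SLAB (L5): the OUTER routes T1/T2/T3 (exit on layer 1, two explicit edges straight
# out, plate steps in the face box beyond) and case lemma O1 of the router

Support file (`--supports stmt-CriticalPhenomena-4575`, helper) of the FRONTIER TRANSPLANT sub-cell (`fk-continuity/transplant/`,
seat `prim-bschramm-fkt-p1`); builds on p205010 (kernel theorem, internal audit signed; external expert review pending).
0 definitions · 0 named facts · 0 sorries · standard axioms. File 7/18 of the bytes-first package (R60 (3)(β)) of the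
UNFUNDED memo row `T4-SLAB [g122, R60]` (re-described R62 (E)); proposable only on a coordinator ruling.
Registered R63 (cell INBOX l.4709, 2026-08-23); registry row T4s; lead label T4s-07 (fkt-lead L22, l.4677).

HONEST FRAMING (page 1, cell rule). The transplant's theorem of record `ufsc0_of_freeBoundaryHypothesis_r3` (p248245) is
CONDITIONAL on FH AND on TP_FK = `KNFreeTargetHittable d q p`, both OPEN at the same `p` for `q > 1` near `p_c(q)` (⇔ GRC Conj.
(5.103) via K1; barrier note `Literature.Barriers.CriticalPhenomena.SamePFreeBoundaryCriteria`, FBN-01, cited first); the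
transplant is a typed reduction, not a proof of FK continuity. THIS FILE: the OUTER routes (`outer_route`, `outer_faceBox_route`: exit on layer 1 of the collar, two explicit edges
straight out of the level box, then plate steps in the face box beyond the contact's face) and the first case lemma of
the router, `lane_caseO1` (the look box's far set `v + ℓF` extends beyond the contact's own face `(i, σ)`). It proves nothing about either binder and says nothing at `p ↓ p_c(q)`; NOT `_r4`; `_r3` « 2 / 0 ☑ », n_open = 2,
BINDER-OWNERS, FO-19 NO-GO unchanged.

Declarations: `outer_route`, `outer_faceBox_route`, `lane_caseO1`.

References: G. Grimmett, *The Random-Cluster Model*, Springer 2006, Thm. (3.1) eq. (3.4), Thm. (3.7), Thm. (3.8), Thm. (3.21)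
eq. (3.22), Lemma (4.13), §5.7 [Grimmett2006]; G. Kozma, S. Nitzan, arXiv:2401.12397 (2024), §4 Lemma 10 Step IV (pp. 19–21) [KozmaNitzan2024].
-/

noncomputable section

namespace Summit.CriticalPhenomena.PercolationContinuityZ3.Theorems.FK

open MeasureTheory
open scoped ENNReal Classical
open Literature.Probability.Percolation Literature.Probability.LatticeModels SimpleGraph
open Literature.Probability.Percolation.GadgetSystem Literature.Probability.Percolation.KozmaNitzan Transplant
open Literature.Barriers.CriticalPhenomena

variable {d : ℕ}

/-! ### (P1) v5 — ROUTES T1/T2/T3 (outer): exit on layer 1, two edges straight out, the face box beyond the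
contact's face `(i, σ)`, optionally one more face box beyond another face `(f, τf)`, `f ≠ c` -/

/-- **Route T1 (outer, one face box).** Exit `z` on layer 1 (`z_i = yi - σ`), the layer-0 vertex `z + σe_i`, the
first outside vertex `x₂ = z + 2σe_i`, then the face box `[aI, bI]` beyond `(i, σ)` (fatness `N`, `m` steps) to the
target `P`: `p̃² · β^{d m} ≤ φ^free_R(z ↔ P in R)`, `R = (U ∩ slab) ∖ (S ∖ {z, w})` (`w` arbitrary).
[cite: KozmaNitzan2024, §4 Lemma 10 Step IV (pp. 19–21); Grimmett2006, Thm. (3.1) eq. (3.4), Thm. (3.8), eq. (3.22), §5.7 eq. (5.102)] -/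
theorem outer_route {q : ℝ} (hq : 1 ≤ q) (p : unitInterval) (hd : 3 ≤ d) {L : ℕ}
    {β : ℝ} (hβ0 : 0 ≤ β) (hβ1 : β ≤ 1)
    (hβ : ∀ (N : ℕ) (g : zdGraph d ≃g zdGraph d) (u z : Site d), u ∈ fkSlab d L N → z ∈ fkSlab d L N →
      β ≤ (fkLaw ((fkSlab d L N).image g) (restrW (↑((fkSlab d L N).image g) : Set (Site d)) (lattW d p)) q).real
        (openConnIn (↑((fkSlab d L N).image g) : Set (Site d)) (g u) (g z)))
    (Lo Hi : Site d) (i : Fin d) (σ yi : ℤ) (hface : (σ = 1 ∧ yi = Hi i) ∨ (σ = -1 ∧ yi = Lo i))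
    (v : Site d) (S : Finset (Site d)) (hS : S ⊆ Finset.Icc (Lo + 1) (Hi - 1))
    (ℓ : ℕ) (g : Geom d) (hloQ : ∀ b, g.loQ b ≤ -1) (hhiQ : ∀ b, 1 ≤ g.hiQ b) (c : Fin d) (hci : c ≠ i)
    (z w : Site d) (ζ : ℤ) (hzi : z i = yi - σ) (hzc : z c = ζ)
    (hzQ : ∀ b, b ≠ i → v b + ℓ * g.loQ b ≤ z b ∧ z b ≤ v b + ℓ * g.hiQ b)
    (hQi : v i + ℓ * g.loQ i ≤ yi - 1 ∧ yi + 1 ≤ v i + ℓ * g.hiQ i)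
    (hslabQ : v c + ℓ * g.loQ c ≤ ζ - L ∧ ζ + L ≤ v c + ℓ * g.hiQ c)
    (aI bI : ℤ) (haI : v i + ℓ * g.loQ i ≤ aI) (hbI : bI ≤ v i + ℓ * g.hiQ i)
    (hout : ∀ w : ℤ, aI ≤ w → w ≤ bI → 0 ≤ σ * (w - yi)) (hx2 : aI ≤ yi + σ ∧ yi + σ ≤ bI)
    (N m : ℕ) (hN : aI + 2 * (N : ℤ) ≤ bI) (hNℓ : N ≤ ℓ) (hLN : L ≤ N)
    (P : Site d) (hPc : ζ - L ≤ P c ∧ P c ≤ ζ + L) (hPi : aI ≤ P i ∧ P i ≤ bI)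
    (hPb : ∀ b, b ≠ c → b ≠ i → v b + ℓ * g.loQ b ≤ P b ∧ P b ≤ v b + ℓ * g.hiQ b)
    (hdist : ∀ b, b ≠ c → b ≠ i → |z b - P b| ≤ (m : ℤ) * N) (hdisti : |yi + σ - P i| ≤ (m : ℤ) * N)
    (hdistc : |ζ - P c| ≤ (m : ℤ) * L) :
    ((p : ℝ) / (p + q * (1 - p))) ^ 2 * β ^ (d * m) ≤
      (fkLaw (((g.Qset ℓ v).filter fun x => |x c - ζ| ≤ (L : ℤ)) \ (S \ {z, w}))
        (restrW (↑(((g.Qset ℓ v).filter fun x => |x c - ζ| ≤ (L : ℤ)) \ (S \ {z, w})) : Set (Site d))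
          (lattW d p)) q).real
      (openConnIn (↑(((g.Qset ℓ v).filter fun x => |x c - ζ| ≤ (L : ℤ)) \ (S \ {z, w})) : Set (Site d)) z P) := by
  have hq0 : 0 < q := one_pos.trans_le hq
  have hd2 : 2 ≤ d := by omega
  set R := ((g.Qset ℓ v).filter fun x => |x c - ζ| ≤ (L : ℤ)) \ (S \ {z, w}) with hR
  haveI : IsProbabilityMeasure (fkLaw R (restrW (↑R : Set (Site d)) (lattW d p)) q) :=
    isProbabilityMeasure_fkLaw _ _ hq0
  have hσ1 : σ = 1 ∨ σ = -1 := hface.elim (fun h => Or.inl h.1) (fun h => Or.inr h.1)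
  have hL0 : |ζ - ζ| ≤ (L : ℤ) := by rw [sub_self, abs_zero]; positivity
  set x1 : Site d := Function.update z i yi with hx1
  set x2 : Site d := Function.update z i (yi + σ) with hx2def
  -- the three collinear vertices are in the region
  have hmem3 : ∀ s : ℤ, yi - 1 ≤ s → s ≤ yi + 1 → (0 ≤ σ * (s - yi) ∨ Function.update z i s = z) →
      Function.update z i s ∈ R := by
    intro s hs1 hs2 hsS
    refine mem_laneRegion (mem_Qset_of_forall fun b => ?_) ?_ ?_
    · by_cases hb : b = i
      · rw [hb, Function.update_self]; constructor <;> linarith [hQi.1, hQi.2]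
      · rw [Function.update_of_ne hb]; exact hzQ b hb
    · rw [Function.update_of_ne hci, hzc]; exact hL0
    · rcases hsS with h | h
      · exact Or.inl (not_mem_of_face hS hface (by rw [Function.update_self]; exact h))
      · exact Or.inr (Or.inl h)
  have hzR : z ∈ R := by
    have := hmem3 (z i) (by rw [hzi]; rcases hσ1 with h | h <;> omega)
      (by rw [hzi]; rcases hσ1 with h | h <;> omega) (Or.inr (Function.update_eq_self i z))
    rwa [Function.update_eq_self] at this
  have hx1R : x1 ∈ R := hmem3 yi (by linarith) (by linarith) (Or.inl (by rw [sub_self, mul_zero]))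
  have hx2R : x2 ∈ R := hmem3 (yi + σ) (by rcases hσ1 with h | h <;> omega)
    (by rcases hσ1 with h | h <;> omega)
    (Or.inl (by rcases hσ1 with h | h <;> rw [h] <;> norm_num))
  have hadj1 : (zdGraph d).Adj z x1 := by
    refine zdGraph_adj_of_eq_off i (fun j hj => by rw [hx1, Function.update_of_ne hj]) ?_
    rw [hx1, Function.update_self, hzi]
    rcases hσ1 with hσ | hσ <;> rw [hσ]
    · left; ring
    · right; ring
  have hadj2 : (zdGraph d).Adj x1 x2 := by
    refine zdGraph_adj_of_eq_off i (fun j hj => by rw [hx1, hx2def, Function.update_of_ne hj,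
      Function.update_of_ne hj]) ?_
    rw [hx1, hx2def, Function.update_self, Function.update_self]
    rcases hσ1 with hσ | hσ <;> rw [hσ]
    · left; rfl
    · right; ring
  -- the face box beyond `(i, σ)`
  have hBsub := faceBox_subset_laneRegion hS hci.symm hface hslabQ haI hbI hout z w
  obtain ⟨hwideB, hfatB⟩ := faceBox_wide (v := v) (f := i) (c := c) (ζ := ζ) hloQ hhiQ hN hNℓ hLN
  have hx2mem := mem_faceBox (v := v) (f := i) (c := c) (g := g) (ℓ := ℓ) (ζ := ζ) (L := L) (aF := aI) (bF := bI)
    (x := x2) (by rw [hx2def, Function.update_of_ne hci, hzc]; constructor <;> linarith)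
    (by rw [hx2def, Function.update_self]; exact hx2)
    (fun b hbc hbi => by rw [hx2def, Function.update_of_ne hbi]; exact hzQ b hbi)
  have hPmem := mem_faceBox (v := v) (f := i) (c := c) (g := g) (ℓ := ℓ) (ζ := ζ) (L := L) (aF := aI) (bF := bI)
    (x := P) hPc hPi hPb
  have hdc : |x2 c - P c| ≤ (m : ℤ) * L := by rw [hx2def, Function.update_of_ne hci, hzc]; exact hdistc
  have hdistB : ∀ b, b ≠ c → |x2 b - P b| ≤ (m : ℤ) * N := by
    intro b hbc
    by_cases hbi : b = i
    · rw [hbi, hx2def, Function.update_self]; exact hdisti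
    · rw [hx2def, Function.update_of_ne hbi]; exact hdist b hbc hbi
  obtain ⟨e, hei, hec⟩ := Fin.exists_ne_and_ne_of_two_lt i c hd
  have hbox : β ^ (d * m) ≤ (fkLaw R (restrW (↑R : Set (Site d)) (lattW d p)) q).real
      (openConnIn (↑R : Set (Site d)) x2 P) :=
    le_fkLaw_restrW_real_openConnIn_of_subbox hq p hBsub x2 P
      (pow_le_fkLaw_Icc_real_openConnIn_slabBox hq p hd2 hβ0 hβ1 hβ _ _ c i e hei.symm hci.symm hec hwideB N hfatB m
        hx2mem hPmem hdc hdistB)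
  have hπ0 : 0 ≤ (p : ℝ) / (p + q * (1 - p)) := div_nonneg p.2.1 (by nlinarith [p.2.1, p.2.2, hq0])
  have h01 := mul_le_fkLaw_real_openConnIn_trans R _ hq (↑R : Set (Site d)) z x1 x2 hπ0
    (ratio_le_fkLaw_restrW_real_openConnIn_edge hq p R hzR hx1R hadj1)
    (ratio_le_fkLaw_restrW_real_openConnIn_edge hq p R hx1R hx2R hadj2)
  have h012 := mul_le_fkLaw_real_openConnIn_trans R _ hq (↑R : Set (Site d)) z x2 P (mul_nonneg hπ0 hπ0) h01 hbox
  rw [pow_two]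
  exact h012

/-- **Routes T2/T3 (outer, two face boxes).** As route T1 up to a junction `J` of the face box beyond `(i, σ)`,
then ONE further face box `[aF, bF]` beyond a face `(f, τf)`, `f ∉ {c}` (for `f = a` this is route T3), to the
target `t`: `p̃² · β^{d m} · β^{d m₂} ≤ φ^free_R(z ↔ t in R)`.
[cite: KozmaNitzan2024, §4 Lemma 10 Step IV (pp. 19–21); Grimmett2006, Thm. (3.1) eq. (3.4), Thm. (3.8), eq. (3.22), §5.7 eq. (5.102)] -/
theorem outer_faceBox_route {q : ℝ} (hq : 1 ≤ q) (p : unitInterval) (hd : 3 ≤ d) {L : ℕ}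
    {β : ℝ} (hβ0 : 0 ≤ β) (hβ1 : β ≤ 1)
    (hβ : ∀ (N : ℕ) (g : zdGraph d ≃g zdGraph d) (u z : Site d), u ∈ fkSlab d L N → z ∈ fkSlab d L N →
      β ≤ (fkLaw ((fkSlab d L N).image g) (restrW (↑((fkSlab d L N).image g) : Set (Site d)) (lattW d p)) q).real
        (openConnIn (↑((fkSlab d L N).image g) : Set (Site d)) (g u) (g z)))
    (Lo Hi : Site d) (i : Fin d) (σ yi : ℤ) (hface : (σ = 1 ∧ yi = Hi i) ∨ (σ = -1 ∧ yi = Lo i))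
    (v : Site d) (S : Finset (Site d)) (hS : S ⊆ Finset.Icc (Lo + 1) (Hi - 1))
    (ℓ : ℕ) (g : Geom d) (hloQ : ∀ b, g.loQ b ≤ -1) (hhiQ : ∀ b, 1 ≤ g.hiQ b) (c : Fin d) (hci : c ≠ i)
    (z w : Site d) (ζ : ℤ) (hzi : z i = yi - σ) (hzc : z c = ζ)
    (hzQ : ∀ b, b ≠ i → v b + ℓ * g.loQ b ≤ z b ∧ z b ≤ v b + ℓ * g.hiQ b)
    (hQi : v i + ℓ * g.loQ i ≤ yi - 1 ∧ yi + 1 ≤ v i + ℓ * g.hiQ i)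
    (hslabQ : v c + ℓ * g.loQ c ≤ ζ - L ∧ ζ + L ≤ v c + ℓ * g.hiQ c)
    (aI bI : ℤ) (haI : v i + ℓ * g.loQ i ≤ aI) (hbI : bI ≤ v i + ℓ * g.hiQ i)
    (hout : ∀ w : ℤ, aI ≤ w → w ≤ bI → 0 ≤ σ * (w - yi)) (hx2 : aI ≤ yi + σ ∧ yi + σ ≤ bI)
    (N m : ℕ) (hN : aI + 2 * (N : ℤ) ≤ bI) (hNℓ : N ≤ ℓ) (hLN : L ≤ N)
    -- the junction `J` (in both boxes)
    (J : Site d) (hJc : ζ - L ≤ J c ∧ J c ≤ ζ + L) (hJi : aI ≤ J i ∧ J i ≤ bI)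
    (hJb : ∀ b, b ≠ c → b ≠ i → v b + ℓ * g.loQ b ≤ J b ∧ J b ≤ v b + ℓ * g.hiQ b)
    (hdist : ∀ b, b ≠ c → b ≠ i → |z b - J b| ≤ (m : ℤ) * N) (hdisti : |yi + σ - J i| ≤ (m : ℤ) * N)
    (hdistc : |ζ - J c| ≤ (m : ℤ) * L)
    -- the second face box beyond `(f, τf)` and the target
    (f : Fin d) (hfc : f ≠ c) (τf yf : ℤ) (hfaceF : (τf = 1 ∧ yf = Hi f) ∨ (τf = -1 ∧ yf = Lo f))
    (aF bF : ℤ) (haF : v f + ℓ * g.loQ f ≤ aF) (hbF : bF ≤ v f + ℓ * g.hiQ f)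
    (houtF : ∀ w : ℤ, aF ≤ w → w ≤ bF → 0 ≤ τf * (w - yf)) (hJf : aF ≤ J f ∧ J f ≤ bF)
    (N₂ m₂ : ℕ) (hN₂ : aF + 2 * (N₂ : ℤ) ≤ bF) (hN₂ℓ : N₂ ≤ ℓ) (hLN₂ : L ≤ N₂)
    (t : Site d) (htc : ζ - L ≤ t c ∧ t c ≤ ζ + L) (htf : aF ≤ t f ∧ t f ≤ bF)
    (htb : ∀ b, b ≠ c → b ≠ f → v b + ℓ * g.loQ b ≤ t b ∧ t b ≤ v b + ℓ * g.hiQ b)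
    (hdist₂ : ∀ b, b ≠ c → |J b - t b| ≤ (m₂ : ℤ) * N₂) (hdist₂c : |J c - t c| ≤ (m₂ : ℤ) * L) :
    ((p : ℝ) / (p + q * (1 - p))) ^ 2 * β ^ (d * m) * β ^ (d * m₂) ≤
      (fkLaw (((g.Qset ℓ v).filter fun x => |x c - ζ| ≤ (L : ℤ)) \ (S \ {z, w}))
        (restrW (↑(((g.Qset ℓ v).filter fun x => |x c - ζ| ≤ (L : ℤ)) \ (S \ {z, w})) : Set (Site d))
          (lattW d p)) q).real
      (openConnIn (↑(((g.Qset ℓ v).filter fun x => |x c - ζ| ≤ (L : ℤ)) \ (S \ {z, w})) : Set (Site d)) z t) := by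
  have hq0 : 0 < q := one_pos.trans_le hq
  have hd2 : 2 ≤ d := by omega
  set R := ((g.Qset ℓ v).filter fun x => |x c - ζ| ≤ (L : ℤ)) \ (S \ {z, w}) with hR
  haveI : IsProbabilityMeasure (fkLaw R (restrW (↑R : Set (Site d)) (lattW d p)) q) :=
    isProbabilityMeasure_fkLaw _ _ hq0
  have hout1 := outer_route hq p hd hβ0 hβ1 hβ Lo Hi i σ yi hface v S hS ℓ g hloQ hhiQ c hci z w ζ hzi hzc hzQ hQi
    hslabQ aI bI haI hbI hout hx2 N m hN hNℓ hLN J hJc hJi hJb hdist hdisti hdistc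
  -- the J-coordinate `J i` lies in the `U`-range (needed when `i ∉ {c, f}` for the second box)
  have hJmem : ∀ b, b ≠ c → b ≠ f → v b + ℓ * g.loQ b ≤ J b ∧ J b ≤ v b + ℓ * g.hiQ b := by
    intro b hbc hbf
    by_cases hbi : b = i
    · rw [hbi]; exact ⟨haI.trans hJi.1, hJi.2.trans hbI⟩
    · exact hJb b hbc hbi
  have hBsub := faceBox_subset_laneRegion hS hfc hfaceF hslabQ haF hbF houtF z w
  obtain ⟨hwideB, hfatB⟩ := faceBox_wide (v := v) (f := f) (c := c) (ζ := ζ) hloQ hhiQ hN₂ hN₂ℓ hLN₂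
  have hJmem' := mem_faceBox (v := v) (f := f) (c := c) (g := g) (ℓ := ℓ) (ζ := ζ) (L := L) (aF := aF) (bF := bF)
    (x := J) hJc hJf hJmem
  have htmem := mem_faceBox (v := v) (f := f) (c := c) (g := g) (ℓ := ℓ) (ζ := ζ) (L := L) (aF := aF) (bF := bF)
    (x := t) htc htf htb
  obtain ⟨e, hef, hec⟩ := Fin.exists_ne_and_ne_of_two_lt f c hd
  have hbox : β ^ (d * m₂) ≤ (fkLaw R (restrW (↑R : Set (Site d)) (lattW d p)) q).real
      (openConnIn (↑R : Set (Site d)) J t) :=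
    le_fkLaw_restrW_real_openConnIn_of_subbox hq p hBsub J t
      (pow_le_fkLaw_Icc_real_openConnIn_slabBox hq p hd2 hβ0 hβ1 hβ _ _ c f e hef.symm hfc hec hwideB N₂ hfatB m₂
        hJmem' htmem hdist₂c hdist₂)
  have hπ0 : 0 ≤ (p : ℝ) / (p + q * (1 - p)) := div_nonneg p.2.1 (by nlinarith [p.2.1, p.2.2, hq0])
  exact mul_le_fkLaw_real_openConnIn_trans R _ hq (↑R : Set (Site d)) z J t
    (mul_nonneg (pow_nonneg hπ0 _) (pow_nonneg hβ0 _)) hout1 hbox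


/-! ### (P1) v5 — CASE LEMMAS: the lane target and the side conditions, per case of the router

Common data of a contact and a lane (note §1): level box `Icc Lo Hi`, face `(i, σ)` with coordinate `yi`, window
half-sizes `M₀ ≤ M` (sub-plates in the central window of half-size `M₀`; `v` at transverse depth `≥ M+1`),
collar width `T`, frozen set `S`, look data `ℓ, g` (centred box geometry: `Q ⊇ [-1,1]^d`, `F ⊆ Q`, flat direction
`a`, `loF_b ≤ 0 ≤ hiF_b` off `a`), lane direction `c ∉ {i, a}` and position `ζ` with `ζ ∈ I_c` and
`|ζ - v_c| ≤ M₀`, exit `z` (`z_c = ζ`, `|z_b - v_b| ≤ M₀`), fatness unit `Nbig` and step count `mstar` with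
`ℓ·(hiQ_b - loQ_b) + 2M + 2 ≤ mstar·Nbig`. Each case lemma returns the target `t ∈ v + ℓF_g`, the second frozen
vertex `w` (`= z` or not a neighbour of `z`) and the route bound. -/

/-- **Case O1 (outer, direct): `F` reaches beyond the contact's face.** Exit on layer 1; route T1 with the face box
`U ∩ {σ(x_i - yi) ≥ 1} ∩ slab`; target `t = (c ↦ ζ, i ↦ v_i + ℓ·hiF_i (σ = 1) / v_i + ℓ·loF_i (σ = -1), b ↦ v_b + ℓ·loF_b)`.
[cite: KozmaNitzan2024, §4 Lemma 10 Step IV (pp. 19–21); Grimmett2006, Thm. (3.1) eq. (3.4), Thm. (3.8), eq. (3.22), §5.7 eq. (5.102)] -/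
theorem lane_caseO1 {q : ℝ} (hq : 1 ≤ q) (p : unitInterval) (hd : 3 ≤ d) {L : ℕ}
    {β : ℝ} (hβ0 : 0 ≤ β) (hβ1 : β ≤ 1)
    (hβ : ∀ (N : ℕ) (g : zdGraph d ≃g zdGraph d) (u z : Site d), u ∈ fkSlab d L N → z ∈ fkSlab d L N →
      β ≤ (fkLaw ((fkSlab d L N).image g) (restrW (↑((fkSlab d L N).image g) : Set (Site d)) (lattW d p)) q).real
        (openConnIn (↑((fkSlab d L N).image g) : Set (Site d)) (g u) (g z)))
    (Lo Hi : Site d) (i : Fin d) (σ yi : ℤ) (hface : (σ = 1 ∧ yi = Hi i) ∨ (σ = -1 ∧ yi = Lo i))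
    (M₀ M : ℕ) (hM₀ : M₀ ≤ M) (v : Site d) (hvi : v i = yi - σ * ((M : ℤ) + 1))
    (S : Finset (Site d)) (hS : S ⊆ Finset.Icc (Lo + 1) (Hi - 1))
    (ℓ : ℕ) (g : Geom d) (hloQ : ∀ b, g.loQ b ≤ -1) (hhiQ : ∀ b, 1 ≤ g.hiQ b)
    (hFQ : ∀ b, g.loQ b ≤ g.loF b ∧ g.hiF b ≤ g.hiQ b) (hF : ∀ b, g.loF b ≤ g.hiF b)
    (c : Fin d) (hci : c ≠ i) (ζ : ℤ) (hζI : v c + ℓ * g.loF c ≤ ζ ∧ ζ ≤ v c + ℓ * g.hiF c) (hζv : |ζ - v c| ≤ M₀)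
    (z : Site d) (hzi : z i = yi - σ) (hzc : z c = ζ) (hzv : ∀ b, b ≠ i → |z b - v b| ≤ M₀)
    (Nbig mstar : ℕ) (hLN : L ≤ Nbig) (hℓ : (M : ℤ) + 2 * L + 2 * Nbig + 2 ≤ ℓ)
    (hm : ∀ b, (ℓ : ℤ) * g.hiQ b - ℓ * g.loQ b + 2 * M + 2 ≤ (mstar : ℤ) * Nbig)
    (hO1 : (σ = 1 ∧ 1 ≤ g.hiF i) ∨ (σ = -1 ∧ g.loF i ≤ -1)) :
    ∃ t w : Site d, t ∈ g.Fset ℓ v ∧ (z = w ∨ ¬ (zdGraph d).Adj z w) ∧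
      ((p : ℝ) / (p + q * (1 - p))) ^ 2 * β ^ (d * mstar) ≤
        (fkLaw (((g.Qset ℓ v).filter fun x => |x c - ζ| ≤ (L : ℤ)) \ (S \ {z, w}))
          (restrW (↑(((g.Qset ℓ v).filter fun x => |x c - ζ| ≤ (L : ℤ)) \ (S \ {z, w})) : Set (Site d))
            (lattW d p)) q).real
        (openConnIn (↑(((g.Qset ℓ v).filter fun x => |x c - ζ| ≤ (L : ℤ)) \ (S \ {z, w})) : Set (Site d)) z t) := by
  -- linear facts (products are atoms)
  have hℓ0 : (0 : ℤ) ≤ ℓ := Nat.cast_nonneg ℓ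
  have hA : ∀ b, (ℓ : ℤ) * g.loQ b ≤ -ℓ := fun b => by
    have := mul_le_mul_of_nonneg_left (hloQ b) hℓ0; linarith
  have hB : ∀ b, (ℓ : ℤ) ≤ ℓ * g.hiQ b := fun b => by
    have := mul_le_mul_of_nonneg_left (hhiQ b) hℓ0; linarith
  have hAF : ∀ b, (ℓ : ℤ) * g.loQ b ≤ ℓ * g.loF b := fun b => mul_le_mul_of_nonneg_left (hFQ b).1 hℓ0
  have hFF : ∀ b, (ℓ : ℤ) * g.loF b ≤ ℓ * g.hiF b := fun b => mul_le_mul_of_nonneg_left (hF b) hℓ0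
  have hFB : ∀ b, (ℓ : ℤ) * g.hiF b ≤ ℓ * g.hiQ b := fun b => mul_le_mul_of_nonneg_left (hFQ b).2 hℓ0
  have hM₀' : (M₀ : ℤ) ≤ M := by exact_mod_cast hM₀
  have hzv' : ∀ b, b ≠ i → v b - M₀ ≤ z b ∧ z b ≤ v b + M₀ := fun b hb => by
    have := hzv b hb; rw [abs_le] at this; constructor <;> linarith [this.1, this.2]
  have hζv' : v c - M₀ ≤ ζ ∧ ζ ≤ v c + M₀ := by rw [abs_le] at hζv; constructor <;> linarith [hζv.1, hζv.2]
  -- the `i`-interval of the face box beyond `(i, σ)` and the target's `i`-coordinate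
  set aI : ℤ := if σ = 1 then yi + 1 else v i + ℓ * g.loQ i with haI
  set bI : ℤ := if σ = 1 then v i + ℓ * g.hiQ i else yi - 1 with hbI
  set tI : ℤ := v i + ℓ * (if σ = 1 then g.hiF i else g.loF i) with htI
  have hI : v i + ℓ * g.loQ i ≤ aI ∧ bI ≤ v i + ℓ * g.hiQ i ∧ aI + 2 * (Nbig : ℤ) ≤ bI ∧
      (∀ w : ℤ, aI ≤ w → w ≤ bI → 0 ≤ σ * (w - yi)) ∧ (aI ≤ yi + σ ∧ yi + σ ≤ bI) ∧ (aI ≤ tI ∧ tI ≤ bI) ∧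
      (v i + ℓ * g.loF i ≤ tI ∧ tI ≤ v i + ℓ * g.hiF i) ∧ |yi + σ - tI| ≤ (mstar : ℤ) * Nbig ∧
      (v i + ℓ * g.loQ i ≤ yi - 1 ∧ yi + 1 ≤ v i + ℓ * g.hiQ i) := by
    have hmi := hm i
    rcases hface with ⟨hσ, -⟩ | ⟨hσ, -⟩
    · have h1 : 1 ≤ g.hiF i := by
        rcases hO1 with ⟨_, h⟩ | ⟨h, _⟩
        · exact h
        · rw [hσ] at h; norm_num at h
      have h1' : (ℓ : ℤ) ≤ ℓ * g.hiF i := by have := mul_le_mul_of_nonneg_left h1 hℓ0; linarith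
      simp only [haI, hbI, htI, hσ, if_true]
      rw [hσ] at hvi
      refine ⟨by linarith [hA i], le_rfl, by linarith [hB i], fun w hw _ => by linarith, ⟨le_rfl, by linarith [hB i]⟩,
        ⟨by linarith, by linarith [hFB i]⟩, ⟨by linarith [hFF i], le_rfl⟩, ?_, ⟨by linarith [hA i], by linarith [hB i]⟩⟩
      rw [abs_le]; constructor <;> linarith [hFB i, hA i, hB i]
    · have h1 : g.loF i ≤ -1 := by
        rcases hO1 with ⟨h, _⟩ | ⟨_, h⟩
        · rw [hσ] at h; norm_num at h
        · exact h
      have h1' : (ℓ : ℤ) * g.loF i ≤ -ℓ := by have := mul_le_mul_of_nonneg_left h1 hℓ0; linarith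
      simp only [haI, hbI, htI, hσ, show (-1 : ℤ) ≠ 1 by norm_num, if_false]
      rw [hσ] at hvi
      refine ⟨le_rfl, by linarith [hB i], by linarith [hA i], fun w _ hw => by linarith, ⟨by linarith [hA i], by linarith⟩,
        ⟨by linarith [hAF i], by linarith⟩, ⟨le_rfl, by linarith [hFF i]⟩, ?_, ⟨by linarith [hA i], by linarith [hB i]⟩⟩
      rw [abs_le]; constructor <;> linarith [hAF i, hA i, hB i]
  obtain ⟨haQ, hbQ, hIN, hIout, hx2I, htII, htIF, hdistI, hQi⟩ := hI
  -- the target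
  set t : Site d := fun b => if b = c then ζ else if b = i then tI else v b + ℓ * g.loF b with htdef
  have htF : t ∈ g.Fset ℓ v := by
    rw [Geom.Fset, mem_Icc_iff]
    intro b
    simp only [Pi.add_apply, Pi.smul_apply, smul_eq_mul, htdef]
    by_cases hbc : b = c
    · rw [if_pos hbc, hbc]; exact hζI
    · rw [if_neg hbc]
      by_cases hbi : b = i
      · rw [if_pos hbi, hbi]; exact htIF
      · rw [if_neg hbi]; exact ⟨le_rfl, by linarith [hFF b]⟩
  refine ⟨t, z, htF, Or.inl rfl, ?_⟩
  have hLℓ : (Nbig : ℤ) ≤ ℓ := by linarith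
  refine outer_route hq p hd hβ0 hβ1 hβ Lo Hi i σ yi hface v S hS ℓ g hloQ hhiQ c hci z z ζ hzi hzc
    (fun b hb => ⟨by linarith [hzv' b hb, hA b], by linarith [hzv' b hb, hB b]⟩) hQi
    ⟨by linarith [hζv'.1, hA c], by linarith [hζv'.2, hB c]⟩ aI bI haQ hbQ hIout hx2I Nbig mstar hIN
    (by exact_mod_cast hLℓ) hLN t ?_ ?_ ?_ ?_ ?_ ?_
  · simp only [htdef, if_true]; constructor <;> linarith
  · simp only [htdef, if_neg hci.symm, if_true]; exact htII
  · intro b hbc hbi; simp only [htdef, if_neg hbc, if_neg hbi]; constructor <;> linarith [hAF b, hFF b, hFB b]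
  · intro b hbc hbi; simp only [htdef, if_neg hbc, if_neg hbi]
    have := hm b; rw [abs_le]; constructor <;> linarith [hzv' b hbi, hAF b, hFF b, hFB b, hA b, hB b]
  · simp only [htdef, if_neg hci.symm, if_true]; exact hdistI
  · simp only [htdef, if_true, sub_self, abs_zero]; positivity

end Summit.CriticalPhenomena.PercolationContinuityZ3.Theorems.FK

end
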